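import Summits.BirchSwinnertonDyer.BirchSwinnertonDyer.Theorems.KolyvaginDepthDoorDepthTableKuriharaExact664a1
import Summits.BirchSwinnertonDyer.Rank1Residual.Supersingular.CountPointsFast
import HarnessLib

/-!
# Route `KolyvaginDepthDoor`, crux `KolyvaginDepthSupplyKN` (stmt-BirchSwinnertonDyer-22820) —
# DEPTH TABLE v20, ROW `664a1` @ `(11, d_K = -39)` (SPLIT CELL): a SECOND decisive prime `2267` and the AGREEMENT test `1607 ↔ 2267`

Helper file of the lead prover of line `levelone` (kdd-p1 g24; `--supports stmt-BirchSwinnertonDyer-22820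
--as helper`); it closes nothing and BSD is NOT proved by it. Same template as `…KuriharaDecisive709a1B` (second prime +
agreement), on the integral point `P = (133, 586)` of `T₀ = [0, 0, 0, -10647, -593190]` (g23) and the exact reading at `11` of
`…KuriharaExact664a1` (this generation).

* `twistKuriharaBit_iff_unit_2267` — **bit ⟺ unit `δ̃_2267(T₀)`** (`#T̃₀(𝔽_2267) = 2343 = 11·213`, `a_2267(T₀) = -75 ≡ 2 (mod 11)`,
  `213 • P̄ = (1727, 943) ≠ O` by an 11-step chain, `decide`).
* `unit_1607_iff_unit_2267` — the AGREEMENT test: modulo print, `δ̃_1607(T₀)` is a unit ⟺ `δ̃_2267(T₀)` is; two residues that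
  disagree contradict the named print facts or the engine (falsifiable with two residues at level `N_{T₀} = 1009944`).

CONDITIONAL on the named facts displayed and the E-side record claim `hδE`; per curve; nothing class-wide; BSD is NOT proved by
any of this.

References: [Sakamoto2022pSelmer] Lemma 4.4, Lemma 4.6 (1), Thm. 1.2, Thm. 1.5; [Kim2022StructureSelmer] Thm. 1.11, §1.2.2;
[CastellaSano2026] Thm. 3; [SilvermanAEC2009] III.2.3, VII.2.1, VII.3.1; [CremonaAlgorithms1997] Table 1 (664a1).
-/

set_option linter.dupNamespace false

noncomputable section

open scoped Classical NumberField

namespace Summit.BirchSwinnertonDyer.BirchSwinnertonDyer.Theorems.KolyvaginDepthDoor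

open Literature.NumberTheory.EllipticCurves Literature.NumberTheory.EllipticCurves.ModularForms
  WeierstrassCurve NumberField IsDedekindDomain
open Summit.BirchSwinnertonDyer.BirchSwinnertonDyer.Theorems
open Summit.BirchSwinnertonDyer.BirchSwinnertonDyer.Rank2Observatory
open Summit.BirchSwinnertonDyer.BirchSwinnertonDyer.Rank1Residual (IntModel.frobeniusTrace_eq)
open Summit.BirchSwinnertonDyer.Rank1Residual.Supersingular (natCard_point_eq_of_countPoints countPoints_eq_of_fast)
open Summit.BirchSwinnertonDyer.Rank1Residual.Additive (card_torsion_le_of_intModel_of_card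
  isKolyvaginPrime_of_intModel_of_card)

namespace C664a1

/-! ## §1 Kernel: the second decisive prime `2267` -/

/-- `#T̃₀(𝔽_2267) = 2343 = 11·213` for `T₀ = [0, 0, 0, -10647, -593190]` (`2267 ≡ 1 (mod 11)`, `a_2267(T₀) = -75 ≡ 2 (mod 11)`, `11² ∤ 2343`),
kernel-decided (`countPointsFast`). [cite: Kim2022StructureSelmer, §1.2.2 (PDF p. 5)] -/
theorem minTwist39_card_2267 :
    Nat.card (((⟨0, 0, 0, -10647, -593190⟩ : WeierstrassCurve ℤ).map (Int.castRingHom (ZMod 2267))).toAffine.Point) = 2343 :=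
  haveI : Fact (Nat.Prime 2267) := ⟨by norm_num⟩
  natCard_point_eq_of_countPoints 0 0 0 (-10647) (-593190) 2267 (by norm_num) (by decide +kernel) (n := 2343)
    (countPoints_eq_of_fast (by decide +kernel))

/-- **`2267` is a CYCLIC KOLYVAGIN PRIME for `(T₀, 11)`** (`2267 ∤ 11·N_{T₀}`, `2267 ≡ 1`, `a_2267(T₀) ≡ 2 (mod 11)`, `#T̃₀(𝔽_2267)[11] ≤ 11`).
[cite: Kim2022StructureSelmer, §1.2.2 (PDF p. 5)] -/
theorem minTwist39_isCyclicKolyvaginLevel_11_2267 :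
    haveI := minTwist39_isGloballyMinimal; haveI := Fact.mk (by norm_num : Nat.Prime 11);
    IsCyclicKolyvaginLevel ((⟨0, 0, 0, -10647, -593190⟩ : WeierstrassCurve ℤ).map (Int.castRingHom ℚ)) 11 2267 := by
  haveI := minTwist39_isElliptic
  haveI := minTwist39_isGloballyMinimal
  haveI := Fact.mk (by norm_num : Nat.Prime 11)
  haveI : Fact (Nat.Prime 2267) := ⟨by norm_num⟩
  have hℓ : Kato.IsKolyvaginPrime ((⟨0, 0, 0, -10647, -593190⟩ : WeierstrassCurve ℤ).map (Int.castRingHom ℚ)) 11 1 2267 :=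
    isKolyvaginPrime_of_intModel_of_card minTwist39_intModel 11 1 2267 (by norm_num) (by decide +kernel) (by decide)
      minTwist39_card_2267 (by norm_num)
  refine ⟨⟨Nat.squarefree_iff_nodup_primeFactorsList (by norm_num) |>.mpr (by simp), fun ℓ hℓ' ↦ ?_⟩, fun ℓ hℓ' hdvd ↦ ?_⟩
  · rw [show (2267 : ℕ).primeFactors = {2267} from (Nat.Prime.primeFactors (by norm_num)), Finset.mem_singleton] at hℓ'
    exact hℓ' ▸ hℓ
  · obtain rfl := (Nat.prime_dvd_prime_iff_eq hℓ'.out (by norm_num)).mp hdvd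
    exact card_torsion_le_of_intModel_of_card minTwist39_intModel 11 2267 minTwist39_card_2267 (by norm_num)

/-- The double-and-add chain from `P̄` reaches the multiplier `213`. [folklore] -/
theorem chain2267_mult :
    chainMult 1 [(true, (2260 : ZMod 2267), (543 : ZMod 2267)), (false, (713 : ZMod 2267), (1179 : ZMod 2267)), (true, (2184 : ZMod 2267), (1350 : ZMod 2267)), (true, (1840 : ZMod 2267), (2244 : ZMod 2267)), (false, (1745 : ZMod 2267), (268 : ZMod 2267)), (true, (68 : ZMod 2267), (2144 : ZMod 2267)), (true, (666 : ZMod 2267), (664 : ZMod 2267)), (false, (524 : ZMod 2267), (2232 : ZMod 2267)), (true, (345 : ZMod 2267), (908 : ZMod 2267)), (true, (478 : ZMod 2267), (430 : ZMod 2267)), (false, (1727 : ZMod 2267), (943 : ZMod 2267))] = 213 := by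
  decide

/-- The double-and-add chain from `P̄ = (133, 586)` to `213 • P̄ = (1727, 943)` in `T̃₀(𝔽_2267)` CHECKS (tangent / chord
certificates, `decide`). [cite: SilvermanAEC2009, III.2.3] -/
theorem chain2267_ok :
    chainB (⟨0, 0, 0, -10647, -593190⟩ : WeierstrassCurve ℤ) 2267 (((133 : ℤ)) : ZMod 2267) (((586 : ℤ)) : ZMod 2267)
      ((((133 : ℤ)) : ZMod 2267), (((586 : ℤ)) : ZMod 2267))
      [(true, (2260 : ZMod 2267), (543 : ZMod 2267)), (false, (713 : ZMod 2267), (1179 : ZMod 2267)), (true, (2184 : ZMod 2267), (1350 : ZMod 2267)), (true, (1840 : ZMod 2267), (2244 : ZMod 2267)), (false, (1745 : ZMod 2267), (268 : ZMod 2267)), (true, (68 : ZMod 2267), (2144 : ZMod 2267)), (true, (666 : ZMod 2267), (664 : ZMod 2267)), (false, (524 : ZMod 2267), (2232 : ZMod 2267)), (true, (345 : ZMod 2267), (908 : ZMod 2267)), (true, (478 : ZMod 2267), (430 : ZMod 2267)), (false, (1727 : ZMod 2267), (943 : ZMod 2267))] = true := by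
  decide +kernel

/-- **KERNEL: `P = (133, 586)` is not divisible by `11` in `T₀(ℚ_2267)`** — the chain certifies `213 • P̄ ≠ O` in `T̃₀(𝔽_2267)`,
`11·213 = #T̃₀(𝔽_2267)`, and `localNondivisible_of_chainB`. [cite: SilvermanAEC2009, III.2.3, VII.2 Prop. 2.1, VII.3 Prop. 3.1] -/
theorem minTwist39_localNondivisible_2267 :
    haveI : Fact (Nat.Prime 2267) := ⟨by norm_num⟩;
    ∀ Q : (((⟨0, 0, 0, -10647, -593190⟩ : WeierstrassCurve ℤ).map (Int.castRingHom ℚ)).baseChange ℚ_[2267]).toAffine.Point,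
      11 • Q ≠ WeierstrassCurve.Affine.Point.map (W' := ((⟨0, 0, 0, -10647, -593190⟩ : WeierstrassCurve ℤ).map (Int.castRingHom ℚ)).toAffine)
        (S := ℚ) (Algebra.ofId ℚ ℚ_[2267]) (.some ((133 : ℤ) : ℚ) ((586 : ℤ) : ℚ) minTwist39_nonsingular_P) := by
  haveI : Fact (Nat.Prime 2267) := ⟨by norm_num⟩
  have hq : ¬ ((2267 : ℕ) : ℤ) ∣ (⟨0, 0, 0, -10647, -593190⟩ : WeierstrassCurve ℤ).Δ := by decide +kernel
  have hXY : (⟨0, 0, 0, -10647, -593190⟩ : WeierstrassCurve ℤ).toAffine.Equation (133) (586) :=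
    (Affine.equation_iff _ _).mpr (by norm_num)
  have hpk : 11 * 213 = Nat.card (((⟨0, 0, 0, -10647, -593190⟩ : WeierstrassCurve ℤ).map (Int.castRingHom (ZMod 2267))).toAffine.Point) := by
    rw [minTwist39_card_2267]
  exact localNondivisible_of_chainB (⟨0, 0, 0, -10647, -593190⟩ : WeierstrassCurve ℤ) 2267 hq hXY minTwist39_nonsingular_P hpk
    chain2267_mult (by convert chain2267_ok)


/-- **ROW `664a1` @ `(11, -39)`: THE DECISIVE PRIME `2267` — bit ⟺ unit `δ̃_2267(T₀)`** (exact form; second prime). For every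
imaginary quadratic `K` with `d_K = -39`, granted the named facts displayed and the E-side record claim `hδE`: the depth-table
bit holds IF AND ONLY IF «every datum `D` of `T₀` at level `N_{T₀}` with `11 ∤ c_D` and the period transfer has a UNIT mod-`11`
Kurihara number AT `2267`» — the claim of a future tree record `cert_<T₀>` @ `(11, 2267)`. (⟹): bit ⟹ `#Sel_11(E^{(-39)}) ≤ 11`
(§1) ⟹ unit at `2267` (`twistKuriharaClaim_prime_of_natCard_selmerGroup_le`, kernel certificate `minTwist39_localNondivisible_2267`);
(⟸): §1 with `m = 2267` (`ν(2267) = 1`). CONDITIONAL on the named facts and the claim; per curve; BSD is not proved by it.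
[cite: Sakamoto2022pSelmer, Lemma 4.4, Lemma 4.6 (1), Thm. 1.2, Thm. 1.5] [cite: Kim2022StructureSelmer, Thm. 1.11]
[cite: CastellaSano2026, Thm. 3] [cite: CremonaAlgorithms1997, Table 1 (664a1)] -/
theorem twistKuriharaBit_iff_unit_2267
    (h372 : GrossLMS1991.prop37_2_frobeniusCongruence)
    (h3 : Literature.NumberTheory.EllipticCurves.CastellaSano2026_kolyvaginClass_selmerDivisibility_eq_padicValNat_tamagawaProduct)
    (hZ : Literature.NumberTheory.EllipticCurves.Zanarella2019_kolyvaginClass_one_ne_zero_of_not_selmerDivisible)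
    (hHZ : Literature.NumberTheory.EllipticCurves.HowardZanarella_exists_minimal_kolyvaginClass_one_selmerCard_of_ne_zero)
    (hKim : Kim2022_card_selmerGroup_le_pow_of_kuriharaNumber_ne_zero)
    (hSak1 : Sakamoto2022_card_selmerGroup_eq_pow_of_isDeltaMinimal)
    (hSak2 : Sakamoto2022_exists_cyclicLevel_kuriharaNumber_ne_zero)
    (hSak3 : Literature.NumberTheory.EllipticCurves.Sakamoto2022_kuriharaNumber_prime_ne_zero_of_localNondivisible)
    (hnf : exists_isNewformOf) (hMaz : mazur_not_dvd_maninConstant_of_odd)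
    (K : Type) [Field K] [NumberField K] (hK : IsImaginaryQuadratic K) (hD : NumberField.discr K = -39)
    (hδE : haveI := isElliptic_c664a1; haveI := isGloballyMinimal_c664a1;
      haveI : NeZero (((⟨0, 0, 0, -7, 10⟩ : WeierstrassCurve ℤ).map (Int.castRingHom ℚ)).conductorNorm ℤ) := neZero_conductorNorm_of_isElliptic _;
      haveI := Fact.mk (by norm_num : Nat.Prime 11);
      ∀ (D : ModularParametrizationData ((⟨0, 0, 0, -7, 10⟩ : WeierstrassCurve ℤ).map (Int.castRingHom ℚ)) (((⟨0, 0, 0, -7, 10⟩ : WeierstrassCurve ℤ).map (Int.castRingHom ℚ)).conductorNorm ℤ)), ¬ ((11 : ℕ) : ℤ) ∣ D.maninConstant →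
        (∃ u : ℚ, ‖(u : ℚ_[11])‖ = 1 ∧ ((⟨0, 0, 0, -7, 10⟩ : WeierstrassCurve ℤ).map (Int.castRingHom ℚ)).realPeriodRat = u * plusPeriod D.f) →
        ∃ ψ : (ℓ : ℕ) → (ZMod ℓ)ˣ →* Multiplicative (ZMod 11),
          (∀ ℓ ∈ (469019 : ℕ).primeFactors, Function.Surjective (ψ ℓ)) ∧ kuriharaNumber D.f 11 469019 ψ ≠ 0) :
    haveI := isElliptic_c664a1; haveI := isGloballyMinimal_c664a1;
    haveI : NeZero (((⟨0, 0, 0, -7, 10⟩ : WeierstrassCurve ℤ).map (Int.castRingHom ℚ)).conductorNorm ℤ) := neZero_conductorNorm_of_isElliptic _;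
    haveI := minTwist39_isElliptic; haveI := minTwist39_isGloballyMinimal;
    haveI : NeZero (((⟨0, 0, 0, -10647, -593190⟩ : WeierstrassCurve ℤ).map (Int.castRingHom ℚ)).conductorNorm ℤ) := neZero_conductorNorm_of_isElliptic _;
    haveI := Fact.mk (by norm_num : Nat.Prime 11);
    (∃ (Dt : ModularParametrizationData ((⟨0, 0, 0, -7, 10⟩ : WeierstrassCurve ℤ).map (Int.castRingHom ℚ)) (((⟨0, 0, 0, -7, 10⟩ : WeierstrassCurve ℤ).map (Int.castRingHom ℚ)).conductorNorm ℤ)) (β : ℤ)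
      (ι : K →+* ℂ) (ℓ : ℕ) (d : KolyvaginHeegnerData Dt β ι ℓ),
      ℓ.Prime ∧ Zhang2014.IsKolyvaginPrime (((⟨0, 0, 0, -7, 10⟩ : WeierstrassCurve ℤ).map (Int.castRingHom ℚ)).conductorNorm ℤ) ((⟨0, 0, 0, -7, 10⟩ : WeierstrassCurve ℤ).map (Int.castRingHom ℚ)) K 11 ℓ ∧
        d.kolyvaginClass (p := 11) (by norm_num) 1 ≠ 0) ↔
    (∀ (D : ModularParametrizationData ((⟨0, 0, 0, -10647, -593190⟩ : WeierstrassCurve ℤ).map (Int.castRingHom ℚ))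
          (((⟨0, 0, 0, -10647, -593190⟩ : WeierstrassCurve ℤ).map (Int.castRingHom ℚ)).conductorNorm ℤ)),
        ¬ ((11 : ℕ) : ℤ) ∣ D.maninConstant →
        (∃ u : ℚ, ‖(u : ℚ_[11])‖ = 1 ∧
          ((⟨0, 0, 0, -10647, -593190⟩ : WeierstrassCurve ℤ).map (Int.castRingHom ℚ)).realPeriodRat = u * plusPeriod D.f) →
        ∃ ψ : (q : ℕ) → (ZMod q)ˣ →* Multiplicative (ZMod 11),
          (∀ q ∈ (2267 : ℕ).primeFactors, Function.Surjective (ψ q)) ∧ kuriharaNumber D.f 11 2267 ψ ≠ 0) := by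
  haveI := isElliptic_c664a1
  haveI := isGloballyMinimal_c664a1
  haveI iNZ : NeZero (((⟨0, 0, 0, -7, 10⟩ : WeierstrassCurve ℤ).map (Int.castRingHom ℚ)).conductorNorm ℤ) :=
    neZero_conductorNorm_of_isElliptic _
  haveI := minTwist39_isElliptic
  haveI := minTwist39_isGloballyMinimal
  haveI iNZT : NeZero (((⟨0, 0, 0, -10647, -593190⟩ : WeierstrassCurve ℤ).map (Int.castRingHom ℚ)).conductorNorm ℤ) :=
    neZero_conductorNorm_of_isElliptic _
  haveI iP := Fact.mk (by norm_num : Nat.Prime 11)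
  haveI : Fact (Nat.Prime 2267) := ⟨by norm_num⟩
  haveI : NeZero (2267 : ℕ) := ⟨by norm_num⟩
  have hsur : ((⟨0, 0, 0, -7, 10⟩ : WeierstrassCurve ℤ).map (Int.castRingHom ℚ)).HasSurjectiveModNGaloisRep ((11 : ℕ) : ℤ) := by
    simpa using hasSurjectiveModNGaloisRep_11
  have hpD : ¬ (((11 : ℕ) : ℤ) ∣ NumberField.discr K) := by rw [hD]; decide
  have hC : (⟨1, (0 : ℚ), (0 : ℚ), (0 : ℚ)⟩ : WeierstrassCurve.VariableChange ℚ) • ((⟨0, 0, 0, -10647, -593190⟩ : WeierstrassCurve ℤ).map (Int.castRingHom ℚ)) =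
      ((⟨0, 0, 0, -7, 10⟩ : WeierstrassCurve ℤ).map (Int.castRingHom ℚ)).quadraticTwist ((NumberField.discr K : ℤ) : ℚ) := by
    rw [hD]; push_cast; exact minTwist39_smul_eq
  have hiff := kolyvaginPrime_iff_twistKuriharaBit_11_neg39 h372 h3 hZ hHZ hKim hSak1 hSak2 hnf hMaz K hK hD hδE
  constructor
  · intro hbit D hc hu
    have hT := (natCard_selmerGroup_quadraticTwist_le_iff_kuriharaBit hKim hSak1 hSak2 hnf hMaz _ 11 (by norm_num) goodOrdinary_11.1
      goodOrdinary_11.2 hsur (NumberField.discr_ne_zero K) hpD _ _ hC minTwist39_nonAnomalous_11 minTwist39_kodairaNeron_11 1).mpr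
      (hiff.mp hbit)
    rw [pow_one] at hT
    exact twistKuriharaClaim_prime_of_natCard_selmerGroup_le hSak3 _ 11 (by norm_num) goodOrdinary_11.1 goodOrdinary_11.2 hsur
      (NumberField.discr_ne_zero K) hpD _ _ hC minTwist39_nonAnomalous_11 minTwist39_kodairaNeron_11 hT 2267
      minTwist39_isCyclicKolyvaginLevel_11_2267 _ minTwist39_localNondivisible_2267 D hc hu
  · intro hunit
    refine hiff.mpr fun D hc hu ↦ ?_
    obtain ⟨ψ, hψ, hne⟩ := hunit D hc hu
    refine ⟨2267, inferInstance, minTwist39_isCyclicKolyvaginLevel_11_2267, ?_, ψ, hψ, hne⟩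
    rw [Nat.Prime.primeFactors (by norm_num), Finset.card_singleton]

/-! ## §2 The agreement test -/

/-- **AGREEMENT TEST for row `664a1` @ `(11, -39)`**: modulo the named print facts and the E-side claim, `δ̃_1607(T₀)` is a unit
⟺ `δ̃_2267(T₀)` is a unit (each ⟺ the row's bit). Two computed residues that DISAGREE contradict the print facts named or the
engine — an internal consistency test of the fleet at level `N_{T₀} = 1009944`, falsifiable with two residues. CONDITIONAL; per
curve; BSD is not proved by it. [cite: Sakamoto2022pSelmer, Lemma 4.4, Lemma 4.6 (1)] [cite: CremonaAlgorithms1997, Table 1 (664a1)] -/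
theorem unit_1607_iff_unit_2267
    (h372 : GrossLMS1991.prop37_2_frobeniusCongruence)
    (h3 : Literature.NumberTheory.EllipticCurves.CastellaSano2026_kolyvaginClass_selmerDivisibility_eq_padicValNat_tamagawaProduct)
    (hZ : Literature.NumberTheory.EllipticCurves.Zanarella2019_kolyvaginClass_one_ne_zero_of_not_selmerDivisible)
    (hHZ : Literature.NumberTheory.EllipticCurves.HowardZanarella_exists_minimal_kolyvaginClass_one_selmerCard_of_ne_zero)
    (hKim : Kim2022_card_selmerGroup_le_pow_of_kuriharaNumber_ne_zero)
    (hSak1 : Sakamoto2022_card_selmerGroup_eq_pow_of_isDeltaMinimal)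
    (hSak2 : Sakamoto2022_exists_cyclicLevel_kuriharaNumber_ne_zero)
    (hSak3 : Literature.NumberTheory.EllipticCurves.Sakamoto2022_kuriharaNumber_prime_ne_zero_of_localNondivisible)
    (hnf : exists_isNewformOf) (hMaz : mazur_not_dvd_maninConstant_of_odd)
    (K : Type) [Field K] [NumberField K] (hK : IsImaginaryQuadratic K) (hD : NumberField.discr K = -39)
    (hδE : haveI := isElliptic_c664a1; haveI := isGloballyMinimal_c664a1;
      haveI : NeZero (((⟨0, 0, 0, -7, 10⟩ : WeierstrassCurve ℤ).map (Int.castRingHom ℚ)).conductorNorm ℤ) := neZero_conductorNorm_of_isElliptic _;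
      haveI := Fact.mk (by norm_num : Nat.Prime 11);
      ∀ (D : ModularParametrizationData ((⟨0, 0, 0, -7, 10⟩ : WeierstrassCurve ℤ).map (Int.castRingHom ℚ)) (((⟨0, 0, 0, -7, 10⟩ : WeierstrassCurve ℤ).map (Int.castRingHom ℚ)).conductorNorm ℤ)), ¬ ((11 : ℕ) : ℤ) ∣ D.maninConstant →
        (∃ u : ℚ, ‖(u : ℚ_[11])‖ = 1 ∧ ((⟨0, 0, 0, -7, 10⟩ : WeierstrassCurve ℤ).map (Int.castRingHom ℚ)).realPeriodRat = u * plusPeriod D.f) →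
        ∃ ψ : (ℓ : ℕ) → (ZMod ℓ)ˣ →* Multiplicative (ZMod 11),
          (∀ ℓ ∈ (469019 : ℕ).primeFactors, Function.Surjective (ψ ℓ)) ∧ kuriharaNumber D.f 11 469019 ψ ≠ 0) :
    haveI := minTwist39_isElliptic; haveI := minTwist39_isGloballyMinimal;
    haveI : NeZero (((⟨0, 0, 0, -10647, -593190⟩ : WeierstrassCurve ℤ).map (Int.castRingHom ℚ)).conductorNorm ℤ) := neZero_conductorNorm_of_isElliptic _;
    haveI := Fact.mk (by norm_num : Nat.Prime 11);
    (∀ (D : ModularParametrizationData ((⟨0, 0, 0, -10647, -593190⟩ : WeierstrassCurve ℤ).map (Int.castRingHom ℚ))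
          (((⟨0, 0, 0, -10647, -593190⟩ : WeierstrassCurve ℤ).map (Int.castRingHom ℚ)).conductorNorm ℤ)),
        ¬ ((11 : ℕ) : ℤ) ∣ D.maninConstant →
        (∃ u : ℚ, ‖(u : ℚ_[11])‖ = 1 ∧
          ((⟨0, 0, 0, -10647, -593190⟩ : WeierstrassCurve ℤ).map (Int.castRingHom ℚ)).realPeriodRat = u * plusPeriod D.f) →
        ∃ ψ : (q : ℕ) → (ZMod q)ˣ →* Multiplicative (ZMod 11),
          (∀ q ∈ (1607 : ℕ).primeFactors, Function.Surjective (ψ q)) ∧ kuriharaNumber D.f 11 1607 ψ ≠ 0) ↔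
    (∀ (D : ModularParametrizationData ((⟨0, 0, 0, -10647, -593190⟩ : WeierstrassCurve ℤ).map (Int.castRingHom ℚ))
          (((⟨0, 0, 0, -10647, -593190⟩ : WeierstrassCurve ℤ).map (Int.castRingHom ℚ)).conductorNorm ℤ)),
        ¬ ((11 : ℕ) : ℤ) ∣ D.maninConstant →
        (∃ u : ℚ, ‖(u : ℚ_[11])‖ = 1 ∧
          ((⟨0, 0, 0, -10647, -593190⟩ : WeierstrassCurve ℤ).map (Int.castRingHom ℚ)).realPeriodRat = u * plusPeriod D.f) →
        ∃ ψ : (q : ℕ) → (ZMod q)ˣ →* Multiplicative (ZMod 11),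
          (∀ q ∈ (2267 : ℕ).primeFactors, Function.Surjective (ψ q)) ∧ kuriharaNumber D.f 11 2267 ψ ≠ 0) :=
  (twistKuriharaBit_iff_unit_1607 h372 h3 hZ hHZ hKim hSak1 hSak2 hSak3 hnf hMaz K hK hD hδE).symm.trans
    (twistKuriharaBit_iff_unit_2267 h372 h3 hZ hHZ hKim hSak1 hSak2 hSak3 hnf hMaz K hK hD hδE)

end C664a1

end Summit.BirchSwinnertonDyer.BirchSwinnertonDyer.Theorems.KolyvaginDepthDoor

end
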